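import Summits.BirchSwinnertonDyer.BirchSwinnertonDyer.Theorems.CMKolyvaginAtInertTwoInertOrderSplittingHabitat
import HarnessLib

/-!
# Route `CMKolyvaginAtInertTwo`, crux `CMKolyvaginExactAtInertTwo` (stmt-BirchSwinnertonDyer-24277):
# PARITY FOR LIFTS — a lift of an automorphism `σ` of `K` which moves `√Δ_E ∈ K` acts on `E_K[2]` as a
# TRANSPOSITION (one fixed non-zero point, one moved point): the hypotheses `hfix`/`hmove` of the habitat
# splitting theorem for EVERY such `σ` (not only complex conjugation — e.g. `Gal(L/K_H)` for `L = K_H·F`)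

Seat `bsd-line-cmk2-p1` g10 (cell `bsd-print-cf2`); helper (`--supports stmt-BirchSwinnertonDyer-24277`).
THEOREMS ONLY: no definition, no named fact, no `sorry`; no item is closed; BSD is not proved by this.
Memo `Cruxes/CMExactDescentAtTwo/MEMO-inert-order-splitting.md` §5 (input of S2: the involution
`Gal(L/K_H)` moves `√d_F`, hence `√Δ_E`).

* `prod_sub_perm'` — `∏_{i<j}(x_{p i} − x_{p j}) = sign(p)·∏_{i<j}(x_i − x_j)` (Dokchitser²'s private lemma, re-proved);
* `xco_pointsMap` — a lift acts on abscissae through the field automorphism;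
* `fix_and_move_of_lift_of_neg_sqrt` — for `τ̃` lifting `σ` with `σ r = −r`, `r² = Δ_{E_K}`: `τ̃δ = −δ`
  for Dokchitser²'s `δ` (`16δ² = Δ`), so `τ̃` permutes `{T₀,T₁,T₂}` oddly, i.e. fixes exactly one `T_i`:
  **`∃ X₀ ≠ 0` in `E_K[2]` fixed and `∃ Y₁ ∈ E_K[2]` moved by `τ̃`**;
* `natCard_stable_eq_sq_of_neg_sqrt` — the habitat splitting theorem (`#S = (#S^{σ})²`) for ANY
  involution `σ` moving a square root of `Δ_E` in `K`, given `z` (engine p646198 + habitat p646724).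

References: T. & V. Dokchitser, Math. Z. 2012 (`ℚ(E[2]) ⊃ ℚ(√Δ)`) [DokchitserDokchitserMathZ2012];
Silverman *AEC* III.§1, VIII.§1 [SilvermanAEC2009]; Lang, *Elliptic Functions*, Ch. 10 §4 [Lang1987].
-/

-- single-conjunct summit: `Summit.BirchSwinnertonDyer.BirchSwinnertonDyer.…` repeats the name by design
set_option linter.dupNamespace false
set_option autoImplicit false

noncomputable section

open scoped Classical

namespace Summit.BirchSwinnertonDyer.BirchSwinnertonDyer.Theorems.InertOrderSplittingHabitat

open WeierstrassCurve Field
open Literature.NumberTheory.EllipticCurves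
open Literature.NumberTheory.EllipticCurves.DokchitserDokchitser2012
open Literature.NumberTheory.GaloisRepresentations

universe u v

/-! ## §1 Permutations of three letters and the discriminant product -/

/-- The six permutations of three letters. [folklore] -/
theorem perm_three_cases' (p : Equiv.Perm (Fin 3)) :
    p = 1 ∨ p = Equiv.swap 0 1 ∨ p = Equiv.swap 0 2 ∨ p = Equiv.swap 1 2 ∨
      p = Equiv.swap 0 1 * Equiv.swap 0 2 ∨ p = Equiv.swap 0 1 * Equiv.swap 1 2 := by
  revert p; decide

/-- An ODD permutation of three letters fixes some letter and moves some letter. [folklore] -/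
theorem exists_fixed_and_exists_moved_of_sign_eq_neg_one (p : Equiv.Perm (Fin 3))
    (hp : Equiv.Perm.sign p = -1) : (∃ i, p i = i) ∧ ∃ j, p j ≠ j := by
  revert hp; revert p; decide

/-- `∏_{i<j}(x_{p i} − x_{p j}) = sign(p)·∏_{i<j}(x_i − x_j)` in a field. [folklore] -/
theorem prod_sub_perm' {F : Type*} [Field F] (x : Fin 3 → F) (p : Equiv.Perm (Fin 3)) :
    (x (p 0) - x (p 1)) * (x (p 0) - x (p 2)) * (x (p 1) - x (p 2)) =
      ((Equiv.Perm.sign p : ℤ) : F) * ((x 0 - x 1) * (x 0 - x 2) * (x 1 - x 2)) := by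
  have h01 : (0 : Fin 3) ≠ 1 := by decide
  have h02 : (0 : Fin 3) ≠ 2 := by decide
  have h12 : (1 : Fin 3) ≠ 2 := by decide
  rcases perm_three_cases' p with rfl | rfl | rfl | rfl | rfl | rfl
  · simp
  · rw [Equiv.Perm.sign_swap h01]; simp [Equiv.swap_apply_def]; ring
  · rw [Equiv.Perm.sign_swap h02]; simp [Equiv.swap_apply_def]; ring
  · rw [Equiv.Perm.sign_swap h12]; simp [Equiv.swap_apply_def]; ring
  · rw [Equiv.Perm.sign_mul, Equiv.Perm.sign_swap h01, Equiv.Perm.sign_swap h02]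
    simp [Equiv.swap_apply_def, Equiv.Perm.mul_apply]; ring
  · rw [Equiv.Perm.sign_mul, Equiv.Perm.sign_swap h01, Equiv.Perm.sign_swap h12]
    simp [Equiv.swap_apply_def, Equiv.Perm.mul_apply]; ring

/-! ## §2 Lifts act on abscissae; the transposition property -/

section Lift

variable {k : Type v} {K : Type u} [Field k] [Field K] [Algebra k K] (W : WeierstrassCurve k)
variable {σ : K ≃ₐ[k] K} {τ : AlgebraicClosure K ≃+* AlgebraicClosure K}

/-- A lift acts on the abscissa of a point through the field automorphism: `x(τ̃P) = τ̃ x(P)`.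
[cite: SilvermanAEC2009, VIII.§1] -/
theorem xco_pointsMap (hτ : IsLiftOfAut σ τ) (P : geomPoints (W.baseChange K)) :
    xco (W.baseChange K) (hτ.pointsMap W P) = τ (xco (W.baseChange K) P) := by
  change ((W.baseChange K).baseChange (AlgebraicClosure K)).toAffine.Point at P
  rcases P with _ | ⟨x, y, h⟩
  · change xco (W.baseChange K) (hτ.pointsMap W 0) = τ 0
    rw [map_zero, map_zero]; rfl
  · rfl

variable [W.IsElliptic] [CharZero K]

/-- **A lift of `σ` with `σ(√Δ) = −√Δ` is a transposition on `E_K[2]`**: it fixes a non-zero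
`2`-torsion point and moves one. [cite: DokchitserDokchitserMathZ2012, Theorem (1), proof] -/
theorem fix_and_move_of_lift_of_neg_sqrt (hτ : IsLiftOfAut σ τ) {r : K}
    (hr : r ^ 2 = (W.baseChange K).Δ) (hσr : σ r = -r) :
    (∃ X₀ : geomPoints (W.baseChange K), X₀ ≠ 0 ∧ (2 : ℤ) • X₀ = 0 ∧ hτ.pointsMap W X₀ = X₀) ∧
      (∃ Y₁ : geomPoints (W.baseChange K), (2 : ℤ) • Y₁ = 0 ∧ hτ.pointsMap W Y₁ ≠ Y₁) := by
  haveI : (W.baseChange K).IsElliptic := by rw [baseChange]; infer_instance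
  set V := W.baseChange K with hV
  have h2 : (2 : K) ≠ 0 := two_ne_zero
  -- the lift on `E_K[2]`, as an additive automorphism
  have hinj : Function.Injective (hτ.torsionMap W 2) := by
    intro P Q h
    apply Subtype.ext
    have h' := congrArg Subtype.val h
    simp only [IsLiftOfAut.coe_torsionMap] at h'
    -- `pointsMap` is injective
    have hpi : Function.Injective (hτ.pointsMap W) := by
      refine (injective_iff_map_eq_zero _).mpr fun P hP ↦ ?_
      change ((W.baseChange K).baseChange (AlgebraicClosure K)).toAffine.Point at P
      rcases P with _ | ⟨x, y, h⟩
      · rfl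
      · exact absurd hP (by rintro ⟨⟩)
    exact hpi h'
  haveI : Finite (geomTorsion V 2) := by
    have hc : Nat.card (geomTorsion V ((2 ^ 1 : ℕ) : ℤ)) = 4 ^ 1 :=
      Summit.BirchSwinnertonDyer.Rank1Residual.P2.CartanAtTwo.natCard_geomTorsion_two_pow V 1
    have hc' : Nat.card (geomTorsion V 2) = 4 := by simpa using hc
    exact Nat.finite_of_card_ne_zero (by rw [hc']; norm_num)
  set φ : geomTorsion V 2 ≃+ geomTorsion V 2 :=
    AddEquiv.ofBijective (hτ.torsionMap W 2) ⟨hinj, Finite.surjective_of_injective hinj⟩ with hφ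
  have hφ_apply : ∀ P : geomTorsion V 2, (φ P : geomPoints V) = hτ.pointsMap W P := fun P ↦ rfl
  set π := perm V h2 φ with hπ
  -- `τ̃ x_i = x_{π i}`
  have hx : ∀ i, τ (xT V h2 i) = xT V h2 (π i) := fun i ↦ by
    rw [xT, xT, T_perm, hφ_apply, xco_pointsMap]
  -- `τ̃ δ = sign(π) δ`
  have hδπ : τ (delta V h2) = ((Equiv.Perm.sign π : ℤ) : AlgebraicClosure K) * delta V h2 := by
    simp only [delta, map_mul, map_sub, hx]
    exact prod_sub_perm' (xT V h2) π
  -- `τ̃ δ = -δ` from `σ r = -r`, `r² = Δ = 16 δ²`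
  have hΔ := algebraMap_Δ V h2
  have hr' : (algebraMap K (AlgebraicClosure K) r) ^ 2 = (4 * delta V h2) ^ 2 := by
    rw [← map_pow, hr, hΔ]; ring
  have hτr : τ (algebraMap K (AlgebraicClosure K) r) = -algebraMap K (AlgebraicClosure K) r := by
    rw [hτ, hσr, map_neg]
  have h4 : (4 : AlgebraicClosure K) ≠ 0 := by
    have : (4 : AlgebraicClosure K) = algebraMap K (AlgebraicClosure K) 4 := (map_ofNat _ 4).symm
    rw [this]; exact (map_ne_zero _).mpr (by norm_num)
  have hδneg : τ (delta V h2) = -delta V h2 := by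
    rcases eq_or_eq_neg_of_sq_eq_sq _ _ hr' with h | h
    · have hd : delta V h2 = algebraMap K (AlgebraicClosure K) r / 4 := by
        rw [h]; field_simp
      rw [hd, map_div₀, hτr, map_ofNat, neg_div]
    · have hd : delta V h2 = -(algebraMap K (AlgebraicClosure K) r) / 4 := by
        rw [h]; field_simp
      rw [hd, map_div₀, map_neg, hτr, map_ofNat, neg_neg, neg_div, neg_neg]
  -- hence `sign π = -1`
  have hsign : Equiv.Perm.sign π = -1 := by
    rcases Int.units_eq_one_or (Equiv.Perm.sign π) with h | h
    · exfalso
      rw [h, hδneg] at hδπ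
      simp only [Units.val_one, Int.cast_one, one_mul] at hδπ
      have h2' : (2 : AlgebraicClosure K) ≠ 0 := by
        rw [show (2 : AlgebraicClosure K) = algebraMap K (AlgebraicClosure K) 2 from (map_ofNat _ 2).symm]
        exact (map_ne_zero _).mpr h2
      apply mul_ne_zero h2' (delta_ne_zero V h2)
      linear_combination -hδπ
    · exact h
  obtain ⟨⟨i, hi⟩, ⟨j, hj⟩⟩ := exists_fixed_and_exists_moved_of_sign_eq_neg_one π hsign
  have h2T : ∀ l, (2 : ℤ) • (T V h2 l : geomPoints V) = 0 := fun l ↦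
    (mem_geomTorsion_iff V 2 _).mp (T V h2 l).2
  refine ⟨⟨T V h2 i, coe_T_ne_zero V h2 i, h2T i, ?_⟩, ⟨T V h2 j, h2T j, fun h ↦ hj ?_⟩⟩
  · rw [← hφ_apply, ← T_perm, ← hπ, hi]
  · apply T_injective V h2
    apply Subtype.ext
    rw [T_perm, hφ_apply]
    exact h

end Lift

/-! ## §3 The habitat splitting theorem for any involution moving `√Δ` -/

section Splitting

variable (W : WeierstrassCurve ℚ) [W.IsElliptic] {K : Type} [Field K] [NumberField K]
variable {σ : K ≃ₐ[ℚ] K} {τ : AlgebraicClosure K ≃+* AlgebraicClosure K}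

/-- **`#S = (#S^{σ})²` for every involution `σ` of `K` moving a square root of `Δ_E`** (any lift `τ̃`;
`η` the equivariant CM generator; `z` a `3`-cycle on `E_K[2]`): `natCard_stable_eq_sq_of_lift` with its
transposition hypotheses discharged by `fix_and_move_of_lift_of_neg_sqrt`.
[cite: Lang1987, Ch. 10 §4, Remark] [cite: DokchitserDokchitserMathZ2012, Theorem (1)] -/
theorem natCard_stable_eq_sq_of_neg_sqrt (hσ : σ * σ = 1) (hτ : IsLiftOfAut σ τ) {r : K}
    (hr : r ^ 2 = (W.baseChange K).Δ) (hσr : σ r = -r)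
    {η : AddMonoid.End (geomPoints (W.baseChange K))} {k₀ c : ℤ}
    (hrel : ∀ P : geomPoints (W.baseChange K), η (η P) + (2 * k₀ + 1) • η P = c • P) (hc : Odd c)
    (hη : ∀ (γ : absoluteGaloisGroup K) (P : geomPoints (W.baseChange K)), γ • η P = η (γ • P))
    {z : absoluteGaloisGroup K}
    (hz : ∀ P : geomPoints (W.baseChange K), (2 : ℤ) • P = 0 → z • P = P → P = 0)
    (M : ℕ) (ηn : geomTorsion (W.baseChange K) ((2 : ℤ) ^ M) →+ geomTorsion (W.baseChange K) ((2 : ℤ) ^ M))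
    (hηn : ∀ P : geomTorsion (W.baseChange K) ((2 : ℤ) ^ M), (ηn P : geomPoints (W.baseChange K)) = η P)
    (hηnG : ∀ (x : absoluteGaloisGroup K) (P : geomTorsion (W.baseChange K) ((2 : ℤ) ^ M)),
      ηn (ContinuousMonoidHom.id (absoluteGaloisGroup K) x • P) = x • ηn P)
    (S : AddSubgroup (galH1Torsion (W.baseChange K) ((2 : ℤ) ^ M)))
    (hSσ : ∀ x ∈ S, conjAct W σ _ x ∈ S)
    (hSη : ∀ x ∈ S, resH1Hom (ContinuousMonoidHom.id _) ηn hηnG x ∈ S) :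
    Nat.card S = Nat.card {x : S // conjAct W σ _ (x : galH1Torsion (W.baseChange K) ((2 : ℤ) ^ M)) = x} ^ 2 :=
  natCard_stable_eq_sq_of_lift W hσ hτ hrel hc hη hz (fix_and_move_of_lift_of_neg_sqrt W hτ hr hσr).1
    (fix_and_move_of_lift_of_neg_sqrt W hτ hr hσr).2 M ηn hηn hηnG S hSσ hSη

end Splitting

end Summit.BirchSwinnertonDyer.BirchSwinnertonDyer.Theorems.InertOrderSplittingHabitat
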